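import Literature.NumberTheory.LFunctions.PageUniformPNT
import Literature.NumberTheory.LFunctions.ExceptionalZeroPsi
import HarnessLib

/-!
# The prime number theorem for progressions to moduli coprime to the exceptional prime, at the
# level `log q ≤ T ≤ √log x` with the saving `exp(−c√log x)` (Landau–Page; FGKMT 2018 (7.4))

Topic `Literature/NumberTheory/LFunctions`; namespace `Literature.NumberTheory.LFunctions.PagePNTExpLevel`.
Everything in this file is PROVED (theorems only).

Source of the statement shape: K. Ford, B. Green, S. Konyagin, J. Maynard, T. Tao, *Long gaps between
primes*, J. Amer. Math. Soc. 31 (2018) 65–105 = arXiv:1412.5029v4, §7, Lemma 7.1, Corollary 5 and the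
proof of Lemma 7.2, display (7.4): with `T = 2c√log x` ... «Lemma 7.1 with the bound
`σ ≥ 1 − c₂/log(q(2+|t|))` ... and Landau–Page give the zero-free region» for all characters of
modulus `≤ e^T` coprime to the exceptional prime `B`, whence `ψ(z; q, a) = z/φ(q) + O(z e^{−c√log z})`
uniformly for such moduli and `z ≤ x log⁴ x`. The engine is Montgomery–Vaughan, *Multiplicative
Number Theory I*, Theorem 11.16 / Corollary 11.17 (the tree's `ExcPsiData.exists_psi_bound`, the
Landau contour argument with a LEVEL PARAMETER `L` in the region `σ > 1 − c/(L + log(|t|+4))`, which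
saves `exp(−(c/80)√log x)` as long as `L ≤ √log x`).

The tree already has the two neighbouring forms: `PageUniformPNT.chebyshevPsiMod_uniform` (relative
error `ε`, `log q ≤ (log x)^b`, `b < 1/4`, via `ClassicalPsiData` whose region
`σ > 1 − c_q/log(|t|+4)`, `c_q ≍ 1/T`, only saves `exp(−c√(log x)/T)` — useless at `T ≍ √log x`) and
`PagePNT.exists_excPsiData` (the level-`log q` data WITH an exceptional zero). This file supplies the
missing one: the level-`T` data WITHOUT exceptional zero for the moduli Page's theorem leaves good.

## Contents

* `region_facts` — bookkeeping: a point of the level-`T` region `σ > 1 − c/(T + log(|t|+4))`,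
  `c = min(c₃, c_P/8, c_ζ, 1/4)`, `log q ≤ T`, lies in the regions where the tree's bounds for
  `ζ₁'/ζ₁` (MV Thm 6.7) and `L'/L(s, χ)` (MV Thm 11.4, `PageUniformPNT.char_facts_of_realZeros`) hold.
* `exists_excPsiData_of_realZeros` — **the hypotheses of Landau's method at level `T`**: for
  `c_P > 0` there are absolute `c ∈ (0, 1/2]`, `K ≥ 0` such that for every modulus `q ≥ 1`, unit `a`,
  and `T ≥ max(1, log q)` such that every real zero of every quadratic non-principal `L(s, χ)` mod `q`
  has `1 − β ≥ c_P/T`, the pair `Λ_{q,a} = φ(q)Λ𝟙_{≡ a (q)}`, `F_{q,a} = φ(q)·LFunctionResidueClassAux a`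
  satisfies `ExcPsiData Λ_{q,a} F_{q,a} c (K q⁵ T) T (1/2) 0` (no exceptional term: `α = 0`).
* `chebyshevPsiMod_bound_of_realZeros` — **MV Cor. 11.17 without exceptional zero, level `T`**:
  `|ψ(x; q, a) − x/φ(q)| ≤ K₁ q⁵ T x exp(−c₁√log x)/φ(q)` for `x ≥ 64`, `T ≤ √log x`, under the same
  hypothesis on the real zeros mod `q`.
* `exists_exceptionalPrime_le` — **Page's theorem, `B`-form with the size of `B`** (FGKMT Lemma 7.1 +
  Corollary 5; the tree's `PageUniformPNT.exists_exceptionalPrime` does not export `B ≤ e^T`): for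
  `T ≥ 1` there is `B`, equal to `1` or to a prime, `B ≤ e^T`, such that all moduli `q` with
  `log q ≤ T`, `(q, B) = 1` satisfy the real-zero hypothesis with an absolute `c_P > 0` (the proof
  of `PageUniformPNT.exists_exceptionalPrime`, keeping track of `B ≤ conductor ≤ q₀ ≤ e^T`).
* `chebyshevPsiMod_bound_coprime` — **FGKMT (7.4) in `ψ`-form**: absolute `0 < c₁ ≤ 1`, `K₁ > 0` such that for
  every `T ≥ 1` there is `B` (`= 1` or prime, `B ≤ e^T`) with
  `|ψ(x; q, a) − x/φ(q)| ≤ K₁ q⁵ T x exp(−c₁√log x)/φ(q)` for all `q ≥ 1`, `log q ≤ T`, `(q, B) = 1`,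
  `(a, q) = 1`, `x ≥ 64`, `T ≤ √log x`.

## References

* K. Ford, B. Green, S. Konyagin, J. Maynard, T. Tao, *Long gaps between primes*, JAMS 31 (2018),
  §7, Lemma 7.1, Corollary 5, (7.4) [FordGreenKonyaginMaynardTao2018].
* H. L. Montgomery, R. C. Vaughan, *Multiplicative Number Theory I*, CUP 2007, Theorems 11.3, 11.4,
  11.16, Corollaries 11.8–11.10, 11.17 [MontgomeryVaughan2007].
-/

noncomputable section

open Complex Filter Topology Set Finset
open scoped LSeries.notation ArithmeticFunction.vonMangoldt

namespace Literature.NumberTheory.LFunctions.PagePNTExpLevel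

open Literature.NumberTheory.LFunctions.PageUniformPNT (char_facts_of_realZeros log_four_le_three)

/-! ## The level-`T` region -/

/-- A point of the region `σ > 1 − c/(T + log(|t|+4))` with `c ≤ min(c₃, c_P/8, c_ζ, 1/4)`,
`1 ≤ T`, `log q ≤ T` satisfies `σ > 3/4`, `σ > 1 − (c_P/T)/8`, `σ ≥ 1 − c_ζ/log(|t|+4)` and
`σ ≥ 1 − c₃/(log q + log(|t|+4))`. [folklore] -/
private theorem region_facts {q : ℕ} {c₃ cζ cP T c : ℝ} (hc₃ : 0 < c₃) (hc0 : 0 < c)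
    (h1 : c ≤ c₃) (h2 : c ≤ cP / 8) (h3 : c ≤ cζ) (h4 : c ≤ 1 / 4) (hT1 : 1 ≤ T)
    (hqT : Real.log q ≤ T) {s : ℂ} (hs : 1 - c / (T + Real.log (|s.im| + 4)) < s.re) :
    3 / 4 < s.re ∧ 1 - cP / T / 8 < s.re ∧ 1 - cζ / Real.log (|s.im| + 4) ≤ s.re ∧
      1 - c₃ / (Real.log q + Real.log (|s.im| + 4)) ≤ s.re := by
  have hlogτ : 1 ≤ Real.log (|s.im| + 4) := ClassicalZFRData.one_le_log_tau s.im
  have hlogτ0 : 0 < Real.log (|s.im| + 4) := by linarith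
  have hlogq : 0 ≤ Real.log q := Real.log_natCast_nonneg q
  have hT0 : 0 < T := by linarith
  have hden : 1 ≤ T + Real.log (|s.im| + 4) := by linarith
  have hden0 : 0 < T + Real.log (|s.im| + 4) := by linarith
  have hc1 : c / (T + Real.log (|s.im| + 4)) ≤ c := div_le_self hc0.le hden
  refine ⟨by linarith, ?_, ?_, ?_⟩
  · have hA : c / (T + Real.log (|s.im| + 4)) ≤ c / T :=
      div_le_div_of_nonneg_left hc0.le hT0 (by linarith)
    have hB : c / T ≤ cP / 8 / T := div_le_div_of_nonneg_right h2 hT0.le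
    have hC : cP / T / 8 = cP / 8 / T := by ring
    linarith
  · have hA : c / (T + Real.log (|s.im| + 4)) ≤ c / Real.log (|s.im| + 4) :=
      div_le_div_of_nonneg_left hc0.le hlogτ0 (by linarith)
    have hB : c / Real.log (|s.im| + 4) ≤ cζ / Real.log (|s.im| + 4) :=
      div_le_div_of_nonneg_right h3 hlogτ0.le
    linarith
  · have hpos : 0 < Real.log q + Real.log (|s.im| + 4) := by linarith
    have hA : c / (T + Real.log (|s.im| + 4)) ≤ c₃ / (T + Real.log (|s.im| + 4)) :=
      div_le_div_of_nonneg_right h1 hden0.le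
    have hB : c₃ / (T + Real.log (|s.im| + 4)) ≤ c₃ / (Real.log q + Real.log (|s.im| + 4)) :=
      div_le_div_of_nonneg_left hc₃.le hpos (by linarith)
    linarith

/-! ## The hypotheses of Landau's method at level `T` (no exceptional zero) -/

/-- Bookkeeping for the constant: `C_ζ + 3 log q + q · C₃ (log q + log 4)³/min(η/2, 1) ≤ K q⁵ T`
with `η = c_P/T`, `K = C_ζ + 3 + 64 C₃ (2/c_P + 1)`, for `q ≥ 1`, `T ≥ 1`. [folklore] -/
private theorem const_le {q : ℕ} [NeZero q] {Cζ C₃ cP T : ℝ} (hCζ : 0 ≤ Cζ) (hC₃ : 0 ≤ C₃) (hcP : 0 < cP)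
    (hT1 : 1 ≤ T) :
    Cζ + 3 * Real.log q + q * (C₃ * ((Real.log q + Real.log 4) ^ 3 / min (cP / T / 2) 1)) ≤
      (Cζ + 3 + 64 * C₃ * (2 / cP + 1)) * (q : ℝ) ^ 5 * T := by
  have hq1 : (1 : ℝ) ≤ q := by exact_mod_cast NeZero.one_le
  have hq0 : (0 : ℝ) < q := by linarith
  have hT0 : 0 < T := by linarith
  have hlogq : 0 ≤ Real.log q := Real.log_nonneg hq1
  have hlogq' : Real.log q ≤ q := (Real.log_le_sub_one_of_pos hq0).trans (by linarith)
  have hq5 : (q : ℝ) ≤ (q : ℝ) ^ 5 := le_self_pow₀ hq1 (by norm_num)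
  have hq15 : (1 : ℝ) ≤ (q : ℝ) ^ 5 := hq1.trans hq5
  have hq5T : (1 : ℝ) ≤ (q : ℝ) ^ 5 * T := one_le_mul_of_one_le_of_one_le hq15 hT1
  -- piece 1
  have h1 : Cζ ≤ Cζ * ((q : ℝ) ^ 5 * T) := le_mul_of_one_le_right hCζ hq5T
  -- piece 2
  have h2 : 3 * Real.log q ≤ 3 * ((q : ℝ) ^ 5 * T) := by
    have : Real.log q ≤ (q : ℝ) ^ 5 * T :=
      hlogq'.trans (hq5.trans (le_mul_of_one_le_right (by positivity) hT1))
    linarith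
  -- piece 3
  have hmin0 : 0 < min (cP / T / 2) 1 := lt_min (by positivity) one_pos
  have hinv : (min (cP / T / 2) 1)⁻¹ ≤ (2 / cP + 1) * T := by
    have h2cP : 0 ≤ 2 / cP * T := by positivity
    rcases min_choice (cP / T / 2) 1 with h | h <;> rw [h]
    · have hA : (cP / T / 2)⁻¹ = 2 / cP * T := by
        field_simp
      rw [hA]
      nlinarith
    · rw [inv_one]
      nlinarith
  have hlog4 : Real.log q + Real.log 4 ≤ 4 * q := by linarith [log_four_le_three]
  have hlog40 : 0 ≤ Real.log q + Real.log 4 := by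
    have : 0 < Real.log 4 := Real.log_pos (by norm_num); linarith
  have hcube : (Real.log q + Real.log 4) ^ 3 ≤ 64 * (q : ℝ) ^ 3 := by
    calc (Real.log q + Real.log 4) ^ 3 ≤ (4 * (q : ℝ)) ^ 3 := pow_le_pow_left₀ hlog40 hlog4 3
      _ = 64 * (q : ℝ) ^ 3 := by ring
  have h3 : (q : ℝ) * (C₃ * ((Real.log q + Real.log 4) ^ 3 / min (cP / T / 2) 1)) ≤
      64 * C₃ * (2 / cP + 1) * ((q : ℝ) ^ 5 * T) := by
    rw [div_eq_mul_inv]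
    have hq45 : (q : ℝ) * (q : ℝ) ^ 3 ≤ (q : ℝ) ^ 5 := by
      have : (q : ℝ) * (q : ℝ) ^ 3 = (q : ℝ) ^ 4 := by ring
      rw [this]; exact pow_le_pow_right₀ hq1 (by norm_num)
    calc (q : ℝ) * (C₃ * ((Real.log q + Real.log 4) ^ 3 * (min (cP / T / 2) 1)⁻¹))
        ≤ (q : ℝ) * (C₃ * (64 * (q : ℝ) ^ 3 * ((2 / cP + 1) * T))) := by
          gcongr
      _ = 64 * C₃ * (2 / cP + 1) * (((q : ℝ) * (q : ℝ) ^ 3) * T) := by ring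
      _ ≤ 64 * C₃ * (2 / cP + 1) * ((q : ℝ) ^ 5 * T) := by
          gcongr
  calc Cζ + 3 * Real.log q + q * (C₃ * ((Real.log q + Real.log 4) ^ 3 / min (cP / T / 2) 1))
      ≤ Cζ * ((q : ℝ) ^ 5 * T) + 3 * ((q : ℝ) ^ 5 * T) +
          64 * C₃ * (2 / cP + 1) * ((q : ℝ) ^ 5 * T) := by linarith
    _ = (Cζ + 3 + 64 * C₃ * (2 / cP + 1)) * (q : ℝ) ^ 5 * T := by ring

/-- **The hypotheses of Landau's method for `Λ_{q,a}` at level `T`, no exceptional zero**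
(MV Theorem 11.16, Cases 1/3, with the level parameter of `ExcPsiData`): for `c_P > 0` there are
absolute `c ∈ (0, 1/2]` and `K ≥ 0` such that for every `q ≥ 1`, unit `a` mod `q`, and `T ≥ 1` with
`log q ≤ T` such that every real zero `β` of every quadratic non-principal `L(s, χ)` mod `q` has
`c_P/T ≤ 1 − β`, the pair `Λ_{q,a}(n) = φ(q)Λ(n)𝟙_{n ≡ a (q)}`, `F_{q,a} = φ(q)·LFunctionResidueClassAux a`
satisfies `ExcPsiData Λ_{q,a} F_{q,a} c (K q⁵ T) T (1/2) 0`: the region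
`σ > 1 − c/(T + log(|t|+4))`, `c = min(c₃, c_P/8, c_ζ, 1/4)`, contains no zero of any `L(s, χ)` mod
`q` (complex and non-quadratic zeros by MV Theorem 11.3, real zeros of quadratic characters by the
hypothesis), and on it `|F_{q,a}(s)| ≤ (C_ζ + 3 log q + q C₃ (log 4q)³ (2T/c_P + 1)) log(|t|+4)`.
[cite: MontgomeryVaughan2007, Theorem 11.16 (proof, Cases 1 and 3) and Corollary 11.17]
[cite: FordGreenKonyaginMaynardTao2018, §7 proof of Lemma 7.2 (the zero-free region for characters of conductor coprime to B)] -/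
theorem exists_excPsiData_of_realZeros {cP : ℝ} (hcP : 0 < cP) :
    ∃ c : ℝ, 0 < c ∧ c ≤ 1 / 2 ∧ ∃ K : ℝ, 0 ≤ K ∧
      ∀ (q : ℕ) [NeZero q] (a : ZMod q), IsUnit a → ∀ T : ℝ, 1 ≤ T → Real.log q ≤ T →
        (∀ χ : DirichletCharacter ℂ q, χ ^ 2 = 1 → χ ≠ 1 → ∀ β : ℝ, χ.LFunction β = 0 →
          cP / T ≤ 1 - β) →
        ExcPsiData (fun n ↦ (q.totient : ℝ) * ArithmeticFunction.vonMangoldt.residueClass a n)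
          (fun s ↦ (q.totient : ℂ) * ArithmeticFunction.vonMangoldt.LFunctionResidueClassAux a s)
          c (K * (q : ℝ) ^ 5 * T) T (1 / 2) 0 := by
  obtain ⟨c₃, hc₃, C₃, hC₃, hzf, hL⟩ := DirichletZFR.exists_norm_logDeriv_le_of_re_ge
  obtain ⟨cζ, hcζ, Cζ, hCζ, hζ⟩ :=
    Literature.NumberTheory.LFunctions.classicalZFRData_riemannZeta.norm_logDeriv_le
  set c : ℝ := min (min c₃ (cP / 8)) (min cζ (1 / 4)) with hcdef
  have hc0 : 0 < c := lt_min (lt_min hc₃ (by positivity)) (lt_min hcζ (by norm_num))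
  have hcc₃ : c ≤ c₃ := (min_le_left _ _).trans (min_le_left _ _)
  have hccP : c ≤ cP / 8 := (min_le_left _ _).trans (min_le_right _ _)
  have hccζ : c ≤ cζ := (min_le_right _ _).trans (min_le_left _ _)
  have hc4 : c ≤ 1 / 4 := (min_le_right _ _).trans (min_le_right _ _)
  clear_value c
  set K : ℝ := Cζ + 3 + 64 * C₃ * (2 / cP + 1) with hKdef
  have hK0 : 0 ≤ K := by rw [hKdef]; positivity
  refine ⟨c, hc0, by linarith, K, hK0, fun q _ a ha T hT1 hqT hηq ↦ ?_⟩
  have hT0 : 0 < T := by linarith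
  have hq1 : (1 : ℝ) ≤ q := by exact_mod_cast NeZero.one_le
  have hq0 : (0 : ℝ) < q := by linarith
  have hη : 0 < cP / T := by positivity
  -- the bound for `L'/L` of the non-principal characters on the region
  set B : ℝ := C₃ * ((Real.log q + Real.log 4) ^ 3 / min (cP / T / 2) 1) with hBdef
  have hmin0 : 0 < min (cP / T / 2) 1 := lt_min (by positivity) one_pos
  have hB0 : 0 ≤ B := by
    rw [hBdef]
    have : 0 < Real.log 4 := Real.log_pos (by norm_num)
    have : 0 ≤ Real.log q + Real.log 4 := by linarith [Real.log_natCast_nonneg q]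
    positivity
  have hBle : Cζ + 3 * Real.log q + q * B ≤ K * (q : ℝ) ^ 5 * T := by
    rw [hBdef, hKdef]; exact const_le hCζ hC₃ hcP hT1
  -- the analytic facts on the region
  have hregion : ∀ s : ℂ, 1 - c / (T + Real.log (|s.im| + 4)) < s.re →
      DifferentiableAt ℂ
          (fun s ↦ (q.totient : ℂ) * ArithmeticFunction.vonMangoldt.LFunctionResidueClassAux a s) s ∧
        ‖(q.totient : ℂ) * ArithmeticFunction.vonMangoldt.LFunctionResidueClassAux a s‖ ≤
          (Cζ + 3 * Real.log q + q * B) * Real.log (|s.im| + 4) := by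
    intro s hs
    obtain ⟨h34, hη8, hsζ, hs₃⟩ := region_facts hc₃ hc0 hcc₃ hccP hccζ hc4 hT1 hqT hs
    obtain ⟨hζne, hζb⟩ := hζ s (by linarith) hsζ
    have hχ : ∀ χ : DirichletCharacter ℂ q, χ ≠ 1 → χ.LFunction s ≠ 0 ∧
        ‖deriv χ.LFunction s / χ.LFunction s‖ ≤ B * Real.log (|s.im| + 4) := by
      intro χ hχ1
      have := char_facts_of_realZeros hη hzf hL hηq χ hχ1 hη8 hs₃
      rw [← hBdef] at this
      exact this
    exact SiegelWalfisz.residueClassAux_facts a hB0 h34.le hζne hζb hχ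
  refine
    { c_pos := hc0
      c_le := by linarith
      C_nonneg := by positivity
      L_nonneg := hT0.le
      β_ge := le_rfl
      β_lt := by norm_num
      α_le := by simp
      nonneg := fun n ↦
        mul_nonneg (Nat.cast_nonneg _) (ArithmeticFunction.vonMangoldt.residueClass_nonneg a n)
      summable := fun s hs ↦ ?_
      eq := fun s hs ↦ ?_
      differentiableOn := fun s hs ↦ (hregion s hs).1.differentiableWithinAt
      bound := fun s hs _ ↦ ?_ }
  · -- summability for `σ > 1`
    have h1 : LSeriesSummable (↗(ArithmeticFunction.vonMangoldt.residueClass a)) s :=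
      LSeriesSummable_of_abscissaOfAbsConv_lt_re
        ((ArithmeticFunction.vonMangoldt.abscissaOfAbsConv_residueClass_le_one a).trans_lt
          (by exact_mod_cast hs))
    have h2 := h1.smul (q.totient : ℂ)
    refine (LSeriesSummable_congr s fun {n} _ ↦ ?_).1 h2
    simp only [Pi.smul_apply, smul_eq_mul]
    push_cast
    ring
  · -- the identity `∑ Λ_{q,a}(n) n^{-s} = 1/(s−1) + F_{q,a}(s)` (MV (11.22), no exceptional term)
    have hAux := ArithmeticFunction.vonMangoldt.eqOn_LFunctionResidueClassAux ha hs
    have hsm : LSeries (fun n ↦ (((q.totient : ℝ) *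
        ArithmeticFunction.vonMangoldt.residueClass a n : ℝ) : ℂ)) s
        = (q.totient : ℂ) * LSeries (↗(ArithmeticFunction.vonMangoldt.residueClass a)) s := by
      rw [← LSeries_smul]
      refine LSeries_congr (fun {n} _ ↦ ?_) s
      simp only [Pi.smul_apply, smul_eq_mul]
      push_cast
      ring
    rw [hsm]
    simp only at hAux
    rw [hAux]
    have hs1 : s - 1 ≠ 0 := by
      intro h; rw [sub_eq_zero] at h; rw [h] at hs; simp at hs
    have hφ : (q.totient : ℂ) ≠ 0 := by exact_mod_cast (Nat.totient_pos.2 (NeZero.pos q)).ne'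
    simp only [Complex.ofReal_zero, zero_div, sub_zero]
    field_simp
    ring
  · -- the bound on the region
    have hlogτ : 1 ≤ Real.log (|s.im| + 4) := ClassicalZFRData.one_le_log_tau s.im
    have hb := (hregion s hs).2
    have hKq : 0 ≤ K * (q : ℝ) ^ 5 * T := by positivity
    have hl5 : Real.log (|s.im| + 4) ≤ Real.log (|s.im| + 4) ^ 5 := le_self_pow₀ hlogτ (by norm_num)
    have hinv : (1 : ℝ) ≤ 1 + ‖s - ((1 / 2 : ℝ) : ℂ)‖⁻¹ := le_add_of_nonneg_right (inv_nonneg.2 (norm_nonneg _))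
    calc ‖(q.totient : ℂ) * ArithmeticFunction.vonMangoldt.LFunctionResidueClassAux a s‖
        ≤ (Cζ + 3 * Real.log q + q * B) * Real.log (|s.im| + 4) := hb
      _ ≤ K * (q : ℝ) ^ 5 * T * Real.log (|s.im| + 4) :=
          mul_le_mul_of_nonneg_right hBle (by linarith)
      _ ≤ K * (q : ℝ) ^ 5 * T * Real.log (|s.im| + 4) ^ 5 := mul_le_mul_of_nonneg_left hl5 hKq
      _ ≤ K * (q : ℝ) ^ 5 * T * Real.log (|s.im| + 4) ^ 5 * (1 + ‖s - ((1 / 2 : ℝ) : ℂ)‖⁻¹) :=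
          le_mul_of_one_le_right (by positivity) hinv

/-! ## `ψ(x; q, a)` at level `T` -/

/-- **MV Corollary 11.17 at level `T`, no exceptional zero**: for `c_P > 0` there are absolute
`c₁, K₁ > 0` such that for every `q ≥ 1`, unit `a`, `T ≥ 1` with `log q ≤ T` such that all real zeros
of quadratic non-principal `L(s, χ)` mod `q` have `1 − β ≥ c_P/T`, and all `x ≥ 64` with
`T ≤ √log x`: `|ψ(x; q, a) − x/φ(q)| ≤ K₁ q⁵ T x exp(−c₁√log x)/φ(q)`
(`exists_excPsiData_of_realZeros` + `ExcPsiData.exists_psi_bound`; `c₁ = c/80 ≤ 1`).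
[cite: MontgomeryVaughan2007, Corollary 11.17] -/
theorem chebyshevPsiMod_bound_of_realZeros {cP : ℝ} (hcP : 0 < cP) :
    ∃ c₁ : ℝ, 0 < c₁ ∧ c₁ ≤ 1 ∧ ∃ K₁ : ℝ, 0 < K₁ ∧
      ∀ (q : ℕ) [NeZero q] (a : (ZMod q)ˣ) (T : ℝ), 1 ≤ T → Real.log q ≤ T →
        (∀ χ : DirichletCharacter ℂ q, χ ^ 2 = 1 → χ ≠ 1 → ∀ β : ℝ, χ.LFunction β = 0 →
          cP / T ≤ 1 - β) →
        ∀ x : ℝ, 64 ≤ x → T ≤ Real.sqrt (Real.log x) →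
          |Literature.NumberTheory.Sieve.ParityWave0.chebyshevPsiMod q a x - x / q.totient| ≤
            K₁ * (q : ℝ) ^ 5 * T * x * Real.exp (-(c₁ * Real.sqrt (Real.log x))) / q.totient := by
  obtain ⟨c, hc, hc2, K, hK, hdat⟩ := exists_excPsiData_of_realZeros hcP
  obtain ⟨A, hA, hpsi⟩ := ExcPsiData.exists_psi_bound hc hc2
  refine ⟨c / 80, by positivity, by linarith, A * (K + 1), by positivity,
    fun q _ a T hT1 hqT hηq x hx hTx ↦ ?_⟩
  have hx0 : 0 < x := by linarith
  have hq1 : (1 : ℝ) ≤ q := by exact_mod_cast NeZero.one_le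
  have hb := hpsi (hdat q (a : ZMod q) a.isUnit T hT1 hqT hηq) x hx hTx
  rw [SiegelWalfisz.psi_residue_eq] at hb
  simp only [zero_mul, zero_div, sub_zero] at hb
  have hφpos : (0 : ℝ) < q.totient := by exact_mod_cast Nat.totient_pos.2 (NeZero.pos q)
  have hid : Literature.NumberTheory.Sieve.ParityWave0.chebyshevPsiMod q a x - x / q.totient =
      ((q.totient : ℝ) * Literature.NumberTheory.Sieve.ParityWave0.chebyshevPsiMod q a x - x) /
        q.totient := by
    field_simp
  rw [hid, abs_div, abs_of_pos hφpos]
  refine div_le_div_of_nonneg_right (hb.trans ?_) hφpos.le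
  have hq5T : (1 : ℝ) ≤ (q : ℝ) ^ 5 * T :=
    one_le_mul_of_one_le_of_one_le (one_le_pow₀ hq1) hT1
  have h1 : K * (q : ℝ) ^ 5 * T + 1 ≤ (K + 1) * ((q : ℝ) ^ 5 * T) := by nlinarith
  have hE : 0 ≤ x * Real.exp (-(c / 80 * Real.sqrt (Real.log x))) := by positivity
  calc A * (K * (q : ℝ) ^ 5 * T + 1) * x * Real.exp (-(c / 80 * Real.sqrt (Real.log x)))
      = A * (K * (q : ℝ) ^ 5 * T + 1) * (x * Real.exp (-(c / 80 * Real.sqrt (Real.log x)))) := by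
        ring
    _ ≤ A * ((K + 1) * ((q : ℝ) ^ 5 * T)) * (x * Real.exp (-(c / 80 * Real.sqrt (Real.log x)))) := by
        gcongr
    _ = A * (K + 1) * (q : ℝ) ^ 5 * T * x * Real.exp (-(c / 80 * Real.sqrt (Real.log x))) := by
        ring

/-! ## Page's theorem: the exceptional prime and its size -/

/-- **Page's theorem, `B`-form with `B ≤ e^T`** (Landau–Page; FGKMT Lemma 7.1 and Corollary 5;
MV Cor. 11.8–11.10): there is an absolute `c_P > 0` such that for every `T ≥ 1` there is `B : ℕ`,
`B = 1` or `B` prime, `B ≤ e^T`, such that for all `q ≥ 1` with `log q ≤ T` and `(q, B) = 1` every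
real zero `β` of every quadratic non-principal `L(s, χ)` mod `q` has `c_P/T ≤ 1 − β`. This is the
tree's `PageUniformPNT.exists_exceptionalPrime` (same proof, verbatim, from Landau's
`DirichletZFR.exists_landau_min_le`) with the one extra output FGKMT need, the SIZE of `B`: when
`B ≠ 1` it is the least prime factor of the conductor of a quadratic `χ₀` mod `q₀` with
`log q₀ ≤ T`, so `B ≤ conductor χ₀ ≤ q₀ ≤ e^T` (`DirichletCharacter.conductor_dvd_level`).
(`PageUniformPNTConductor.exists_exceptionalConductor` exposes the conductor itself; it is not
imported here to keep this file's import closure inside the built library.)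
[cite: FordGreenKonyaginMaynardTao2018, Lemma 7.1 and Corollary 5]
[cite: MontgomeryVaughan2007, Corollaries 11.8–11.10] -/
theorem exists_exceptionalPrime_le :
    ∃ cP : ℝ, 0 < cP ∧ ∀ T : ℝ, 1 ≤ T → ∃ B : ℕ, (B = 1 ∨ B.Prime) ∧ (B : ℝ) ≤ Real.exp T ∧
      ∀ (q : ℕ) [NeZero q], Real.log q ≤ T → q.Coprime B →
        ∀ χ : DirichletCharacter ℂ q, χ ^ 2 = 1 → χ ≠ 1 →
          ∀ β : ℝ, χ.LFunction β = 0 → cP / T ≤ 1 - β := by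
  classical
  obtain ⟨c, hc, H⟩ := DirichletZFR.exists_landau_min_le
  refine ⟨c / 5, by positivity, fun T hT ↦ ?_⟩
  by_cases hex : ∃ (q₀ : ℕ) (_ : NeZero q₀) (χ₀ : DirichletCharacter ℂ q₀) (β₀ : ℝ),
      Real.log q₀ ≤ T ∧ χ₀ ^ 2 = 1 ∧ χ₀ ≠ 1 ∧ χ₀.LFunction β₀ = 0 ∧ 1 - β₀ < c / 5 / T
  swap
  · -- no exceptional character at all: `B = 1`
    refine ⟨1, Or.inl rfl, ?_, fun q _ hqT _ χ hχ2 hχ1 β hβ ↦ ?_⟩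
    · simpa using Real.one_le_exp (by linarith : (0 : ℝ) ≤ T)
    by_contra hlt
    exact hex ⟨q, inferInstance, χ, β, hqT, hχ2, hχ1, hβ, by linarith⟩
  obtain ⟨q₀, _, χ₀, β₀, hq₀T, hχ₀2, hχ₀1, hβ₀, hβ₀lt⟩ := hex
  have hcond : χ₀.conductor ≠ 1 := fun h ↦
    hχ₀1 (DirichletCharacter.eq_one_iff_conductor_eq_one.mpr h)
  have hprime : χ₀.conductor.minFac.Prime := Nat.minFac_prime hcond
  refine ⟨χ₀.conductor.minFac, Or.inr hprime, ?_, fun q _ hqT hcop χ hχ2 hχ1 β hβ ↦ ?_⟩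
  · -- the size: `B ≤ conductor χ₀ ≤ q₀ ≤ e^T`
    have hc0 : χ₀.conductor ≠ 0 := DirichletCharacter.conductor_ne_zero χ₀
    have h1 : χ₀.conductor.minFac ≤ χ₀.conductor := Nat.minFac_le (Nat.pos_of_ne_zero hc0)
    have h2 : χ₀.conductor ≤ q₀ :=
      Nat.le_of_dvd (NeZero.pos q₀) (DirichletCharacter.conductor_dvd_level χ₀)
    have hq₀0 : (0 : ℝ) < q₀ := by exact_mod_cast NeZero.pos q₀
    have h3 : (q₀ : ℝ) ≤ Real.exp T := by
      have := Real.exp_le_exp.2 hq₀T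
      rwa [Real.exp_log hq₀0] at this
    calc ((χ₀.conductor.minFac : ℕ) : ℝ) ≤ q₀ := by exact_mod_cast h1.trans h2
      _ ≤ Real.exp T := h3
  by_contra hlt
  push Not at hlt
  by_cases hψ : SiegelCoefficients.prodChar χ₀ χ = 1
  · -- `χ₀χ` principal: `χ₀` factors through `gcd(q₀, q)`, so `B ∣ conductor χ₀ ∣ q`
    have hinv : χ⁻¹ = χ := by rw [inv_eq_iff_mul_eq_one, ← sq, hχ2]
    have H' : χ₀.changeLevel (dvd_mul_right q₀ q) = χ.changeLevel (dvd_mul_left q q₀) := by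
      have := eq_inv_of_mul_eq_one_left hψ
      rw [← map_inv, hinv] at this
      exact this
    have hft := DirichletCharacter.factorsThrough_gcd χ₀ χ H'
    have hdvd : χ₀.conductor ∣ q :=
      (DirichletCharacter.conductor_dvd_of_mem_conductorSet χ₀ hft).trans (Nat.gcd_dvd_right q₀ q)
    have hB : χ₀.conductor.minFac ∣ q := (Nat.minFac_dvd _).trans hdvd
    have h1 : χ₀.conductor.minFac = 1 := Nat.Coprime.eq_one_of_dvd (Nat.coprime_comm.mp hcop) hB
    exact hprime.one_lt.ne' h1
  · -- Landau's repulsion for the non-principal `χ₀χ` (mod `q₀q`)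
    haveI : NeZero (q₀ * q) := ⟨Nat.mul_ne_zero (NeZero.ne q₀) (NeZero.ne q)⟩
    have h := H q₀ q (q₀ * q) χ₀ χ (SiegelCoefficients.prodChar χ₀ χ) hχ₀1 hχ1 hψ hχ₀2 hχ2
      (fun n ↦ SiegelCoefficients.prodChar_apply_natCast χ₀ χ n)
      (Nat.le_mul_of_pos_right q₀ (NeZero.pos q)) (Nat.le_mul_of_pos_left q (NeZero.pos q₀))
      β₀ β hβ₀ hβ
    have hq₀0 : (0 : ℝ) < q₀ := by exact_mod_cast NeZero.pos q₀
    have hq0 : (0 : ℝ) < q := by exact_mod_cast NeZero.pos q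
    have hlogmul : Real.log ((q₀ * q : ℕ) : ℝ) = Real.log q₀ + Real.log q := by
      push_cast
      exact Real.log_mul hq₀0.ne' hq0.ne'
    have hsum : Real.log ((q₀ * q : ℕ) : ℝ) + Real.log 4 ≤ 5 * T := by
      rw [hlogmul]
      linarith [log_four_le_three]
    have hpos : 0 < Real.log ((q₀ * q : ℕ) : ℝ) + Real.log 4 := by
      have h1 : 0 ≤ Real.log ((q₀ * q : ℕ) : ℝ) := Real.log_natCast_nonneg _
      have h2 : 0 < Real.log 4 := Real.log_pos (by norm_num)
      linarith
    have hle : c / 5 / T ≤ c / (Real.log ((q₀ * q : ℕ) : ℝ) + Real.log 4) := by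
      rw [div_div]
      exact div_le_div_of_nonneg_left hc.le hpos hsum
    have hmin : 1 - c / 5 / T < min β₀ β := lt_min (by linarith) (by linarith)
    linarith

/-- **FGKMT (7.4) in `ψ`-form — the prime number theorem for progressions to all moduli
`q ≤ e^T` coprime to the exceptional prime, `T ≤ √log x`, saving `exp(−c₁√log x)`**: there are
absolute `c₁, K₁ > 0` such that for every `T ≥ 1` there is `B` (`B = 1` or prime, `B ≤ e^T`) with
`|ψ(x; q, a) − x/φ(q)| ≤ K₁ q⁵ T x exp(−c₁√log x)/φ(q)` for all `q ≥ 1`, `log q ≤ T`, `(q, B) = 1`,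
units `a` mod `q`, `x ≥ 64`, `T ≤ √log x`. (FGKMT take `T = 2c√log x`; the factor `q⁵ T ≤ e^{6T}` is
absorbed by choosing that `c` small against `c₁`.)
[cite: FordGreenKonyaginMaynardTao2018, §7 Lemma 7.1, Corollary 5, proof of Lemma 7.2 eq. (7.4)]
[cite: MontgomeryVaughan2007, Corollary 11.17 with Corollary 11.10] -/
theorem chebyshevPsiMod_bound_coprime :
    ∃ c₁ : ℝ, 0 < c₁ ∧ c₁ ≤ 1 ∧ ∃ K₁ : ℝ, 0 < K₁ ∧ ∀ T : ℝ, 1 ≤ T →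
      ∃ B : ℕ, (B = 1 ∨ B.Prime) ∧ (B : ℝ) ≤ Real.exp T ∧
        ∀ (q : ℕ) [NeZero q], Real.log q ≤ T → q.Coprime B → ∀ (a : (ZMod q)ˣ) (x : ℝ), 64 ≤ x →
          T ≤ Real.sqrt (Real.log x) →
          |Literature.NumberTheory.Sieve.ParityWave0.chebyshevPsiMod q a x - x / q.totient| ≤
            K₁ * (q : ℝ) ^ 5 * T * x * Real.exp (-(c₁ * Real.sqrt (Real.log x))) / q.totient := by
  obtain ⟨cP, hcP, hPage⟩ := exists_exceptionalPrime_le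
  obtain ⟨c₁, hc₁, hc₁1, K₁, hK₁, hψ⟩ := chebyshevPsiMod_bound_of_realZeros hcP
  refine ⟨c₁, hc₁, hc₁1, K₁, hK₁, fun T hT ↦ ?_⟩
  obtain ⟨B, hB, hBT, hgood⟩ := hPage T hT
  exact ⟨B, hB, hBT, fun q _ hqT hcop a x hx hTx ↦
    hψ q a T hT hqT (hgood q hqT hcop) x hx hTx⟩

end Literature.NumberTheory.LFunctions.PagePNTExpLevel
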